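import Summits.PneNP.PneNP.Theses.PhaseTwins
import Literature.Computability.Complexity.StockmeyerMachines
import Literature.Computability.Complexity.OracleEmptyFP
import Literature.Computability.Complexity.ClayProblemProofs

/-!
# PneNP / PhaseTwins — assembly (stmt-PneNP-2718)

Route `PneNP/PhaseTwins`, assembly item `stmt-PneNP-2718`:
`Assembly := HardcoreCountSharpP → NoFBPPApproxAboveUniqueness → PneNP`.

The proof is glue over PROVED bridges of the tree, no named fact is assumed:

* `¬ PneNP` gives `NP ⊆ P` in the prelude classes through the model bridges
  `P_bool_eq_holds`, `NP_bool_eq_holds` (`ClayProblem.lean`, `ClayProblemProofs.lean`);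
* `HardcoreCountSharpP Δ p q` gives a relation `R ∈ P ⊆ P^∅` (`P_subset_PRel_holds`) and a
  polynomial `r` with `countWitnesses R (r |x|) x = N x`, `N` the inlined hard-core count;
* Stockmeyer's relativised approximate counting theorem at the empty oracle
  (`StockMachine.stockmeyerApproxCounting_holds`, Aaronson–Arkhipov 2013 Thm. 4.1) yields
  `L ∈ NP^∅ = NP` (`NPRel_empty`), a transducer `F ∈ FP^L` and a coin budget `c`;
* `L ∈ NP ⊆ P ⊆ P^∅`, so the oracle `Oracle.ofLanguage L` is in `FP^∅ = FP`
  (`OracleAlg.ofLanguage_mem_FPRel_of_mem_PRel`, `FPRel_empty_eq`) and `F ∈ FP`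
  (`FPRel_subset_FP_of_mem_FP`);
* Stockmeyer's guarantee at witness length `m := r |x|` is literally the negated body of
  `NoFBPPApproxAboveUniqueness` at `(Δ, p, q)`. Contradiction.

References: S. Aaronson, A. Arkhipov, *The computational complexity of linear optics*, Theory of
Computing 9 (2013), Thm. 4.1; L. J. Stockmeyer, *On approximation algorithms for #P*, SIAM J.
Comput. 14 (1985); S. Cook, *The P versus NP problem*, Clay problem description (2000), §1.
-/

-- `Summit.PneNP.PneNP.…` duplicates `PneNP` BY DESIGN (single-problem summit, D-0017 layout).
set_option linter.dupNamespace false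

namespace Summit.PneNP.PneNP.Theorems

open Literature.Computability.Complexity

/-- Settles `stmt-PneNP-2718` (assembly of route `PneNP/PhaseTwins`): if the hard-core count is
in `#P` and, above the uniqueness threshold, admits no `FBPP` approximation scheme in the
`countQuery`/`countEstimate` format, then `P ≠ NP` in Cook's form. Under `¬ PneNP` one has
`NP ⊆ P`, so Stockmeyer's `FP^{NP}` approximate counter for the `#P` relation of the hard-core
count (`StockMachine.stockmeyerApproxCounting_holds` at the empty oracle) is an `FP` transducer
with exactly the forbidden guarantee (Aaronson–Arkhipov 2013, Thm. 4.1, after Stockmeyer 1985;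
Cook, Clay problem description, §1). [cite: AaronsonArkhipovToC2013, Thm. 4.1 (p. 175)] -/
theorem phaseTwins_assembly_proof : Summit.PneNP.PneNP.Theses.PhaseTwins.Assembly := by
  unfold Summit.PneNP.PneNP.Theses.PhaseTwins.Assembly
  intro hN hX
  obtain ⟨Δ, p, q, -, -, -, hno⟩ := hX
  by_contra hcon
  -- `¬ PneNP`: every `NP` language is in `P` (model bridges to the prelude classes).
  have hNPP : Nondeterministic.NP ⊆ Classes.P := by
    intro L hL
    by_contra hLP
    exact hcon ⟨L, by rw [show PNPWave0.NP Bool = _ from NP_bool_eq_holds]; exact hL,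
      by rw [show PNPWave0.P Bool = _ from P_bool_eq_holds]; exact hLP⟩
  -- the hard-core count at `(Δ, p, q)` is a `#P` function
  obtain ⟨R, hR, r, hr⟩ := hN Δ p q
  -- Stockmeyer's approximate counter for `R`, relative to the empty oracle
  obtain ⟨L, hL, F, hF, c, hc⟩ :=
    StockMachine.stockmeyerApproxCounting_holds Oracle.empty R (P_subset_PRel_holds _ hR)
  rw [NPRel_empty] at hL
  -- its `NP` oracle is in `P`, hence a polynomial-time function oracle, and `F ∈ FP`
  have hOL : Oracle.ofLanguage L ∈ FP := by
    rw [← FPRel_empty_eq]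
    exact OracleAlg.ofLanguage_mem_FPRel_of_mem_PRel (P_subset_PRel_holds _ (hNPP hL))
  have hFP : F ∈ FP := FPRel_subset_FP_of_mem_FP hOL hF
  -- the guarantee at `m := r |x|` is the forbidden approximation scheme
  refine hno ⟨F, hFP, c, r, fun x kη kδ hkη hkδ => ?_⟩
  have h := hc x (r.eval x.length) kη kδ hkη hkδ
  rw [← hr x] at h
  exact h

end Summit.PneNP.PneNP.Theorems
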